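import Summits.QuantumFields.YangMills.Theorems.BalabanUVNodesPortS1RecordPhiAxZero

/-!
# BalabanUVNodes — port ZD∕S1: the (N-0) normalisation door IS A SELECTOR MISMATCH — the one-step rows `stepOutT`∕`mergedTermT` with the minimiser SELECTOR
# as an argument (as `action21` already has it), their instance at the ROOTED selector `UkSel` (the FE chart's own, `recordBgField … := UkSel … (unitField B)`),
# the UNCONDITIONAL unit row `𝓝^{sel}_{k+1}(1) = 0` at EVERY `k`, and the located identity «`recordΦfAx … 0 = −A_k(Ū^k(Uk_{k+1}(1)))` = exactly the gap between the
# bare-`Uk` row and the `UkSel` row at `W = 1`» (porter ▶ PTC-1 g5; ★★★ director-ym №628 (5) REPAIR (β1); ◆ CRIT-1 g40 critic line nodeO 2026-08-31T18:11:20Z)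

Cell `ym-nodeO-ideate`; `--supports stmt-QuantumFields-27930 --as helper` (NO `--workitem`); count-neutral.  [I] = [Balaban1987RG1]; [15] = [Balaban1985Variational].

WHY.  ✓`…PortS1RecordPhiAxZero.recordΦfAx_apply_zero_of_eq` (▶ PTA-1 g10) reduced FE-1's presupposition `recordΦfAx F a₀ ε₂₉ k v K 0 = 0` (k ≥ 1) to ONE equation
`hinv : A_k(Ū^k(U_{k+1}(1))) = A_k(1)`.  ◆ CRIT-1 g40 located it TO THE TOKEN: `recordΦfAx = ΦfOf (recordTermsAx …)` and `recordTermsAx := mergedTermFamilyMatT …` (names module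
✓`…K0RecordFormatNamesAx` :58) read print's (1.6) `𝓝_{k+1}(W) = A_{k+1}(W) − A_k(Ū^k(U_{k+1}(W)))` through lit `Node00.mergedTermT`, whose minimiser is the BARE choice `Node00.Uk`
(`Classical.choose`, `BackgroundActionOfRecord` :99) — so `U_{k+1}(1)` is an unspecified residual pure gauge `1^u` (✓`orbitRel_one_Uk_one`) and `hinv` asks for POINTWISE gauge
invariance of `A_k` there (only a.e. available: N09's engine) — whereas the FE chart's background is typed with the ROOTED selector `Node00.UkSel` (`recordBgField`, names :344), for which
✓`…PortS1Selector.UkSel_one` gives `U_{k+1}(1) = 1` OUTRIGHT.  Print never meets this door: its `U_k(V)` is gauge-fixed by construction ([15] (1.1) + axial conditions; [I] (2.3)).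
THIS FILE supplies the row a names re-point would read and proves what it buys, WITHOUT touching any name of record:
* §1 `stepOutWithT sel`∕`mergedTermWithT sel`∕`mergedTermFamilyWithT sel`∕`mergedTermFamilyMatWithT sel` — lit `ZeroInput.stepOutT`∕`mergedTermT`∕`mergedTermFamilyT`∕
  `mergedTermFamilyMatT` with the selector `sel : (K k : ℕ) → ℝ → GaugeField (F.P K) k (SU N) → GaugeField (F.P K) 0 (SU N)` as an ARGUMENT (the design of lit `action21`);
  at `sel := Uk F N` they ARE the lit rows (`rfl` ×4).
* §2 ★ `mergedTermWithT_UkSel_one : mergedTermWithT F N (UkSel F N) T χ ε K g k 1 = 0` for EVERY transport `T`, cut-off family `χ`, radius `ε`, history `g` and EVERY `k` with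
  `k + 1 ≤ m + K` — NO invariance hypothesis (compare ✓`PortZD.mergedTermT_one_of_gaugeInvariant`, which needs GLOBAL `GaugeInvariant A_k`): `UkSel … (k+1) ε 1 = 1`
  (`UkSel_one_of_le`, generic `N`), `Ū^k 1 = 1`, `A_k(1) = A_{k+1}(1) = 0` (✓`PortZD.effActionHT_one`).
* §3 the located gap: `mergedTermT … k 1 = −A_k(Ū^k(Uk_{k+1}(1)))`, `mergedTermT … k 1 = 0 ↔ hinv`, and `mergedTermT … k 1 − mergedTermWithT (UkSel) … k 1 = −A_k(Ū^k(Uk_{k+1}(1)))`.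
* §4 at the record (`N = 2`, `θ = thetaFill F a₀ ε₂₉`, history `extd v`): `recordΦfAx … 0 = −A_k(Ū^k(Uk_{k+1}(1)))` (complexified), ★ `recordΦfAx_apply_zero_iff : recordΦfAx … 0 = 0 ↔ hinv`
  (PTA-1's door is EXACTLY the bare-`Uk` gap, nothing more), and for the `UkSel` family read through the SAME chart `ΦfOf … θ.ρ8`:
  `ΦfOf F (mergedTermFamilyMatWithT F 2 (UkSel F 2) …) θ.ρ8 k v K B = 𝓝^{sel}_{k+1}(extd v; W_B)` (`rfl`) and ★★ `… 0 = 0` at EVERY `k` (`k + 1 ≤ m + K`), UNCONDITIONALLY.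
WHAT THIS DOES NOT DO.  It does NOT re-point `recordTermsAx` (a NAMES edition — DEF-1's pen after a consumer census: every module that unfolds `recordΦfAx` to `mergedTermT`
(✓`…PortS1Functional` `rfl` rows, ✓`…PortS1RecordPhiAxZero`, ✓`…PortS1FECurlyLevels`, ✓`…PortS1EkChartUnfold`, …) would re-key on `mergedTermWithT (UkSel F 2)`; modules that treat
`recordΦfAx` abstractly are untouched); with that ONE-TOKEN edition `recordΦfAx … 0 = 0` becomes §4's ★★ by `rfl`, at every `k`, and the (N-0) sentence retires.

HONEST STATUS.  Definitions with the selector displayed + kernel bookkeeping (`rfl` bridges, unit rows, one subtraction); the bare-`Uk` door `hinv` itself is NOT discharged (it is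
relocated to a selector choice, exactly as ◆ said); NOTHING of Bałaban's (1.4)–(1.7), Thm 3, §2–§5, [II] asserted, ported, discharged or refuted; `FEStepBox`∕`FEStepReg` inhabited
nowhere; `stub_FEstep`∕`stub_P0C` OPEN, ⟨27930⟩ 1∕3; NODE O 0∕1; COUNT 8∕28 · K 1∕4 UNMOVED; finite 𝕋⁴_{L^K} at fixed ε — NOT continuum ∕ OS ∕ Clay; **the Yang–Mills mass gap
(Clay) is NOT proved by any of this.**  No `sorry`, `instance`, `notation`; standard axioms.

References: [Balaban1987RG1] T. Bałaban, CMP 109 (1987) — (0.19) p.255, (0.21) p.256, (1.3) p.260, (1.6) p.261, (1.20) p.264, (2.1)∕(2.3) p.265, (2.12) p.268;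
[Balaban1985Variational] T. Bałaban, CMP 102 (1985) — Thm 1 p.279, (181) p.307.
-/

noncomputable section

open scoped BigOperators Matrix.Norms.L2Operator

namespace Summit.QuantumFields.YangMills.Theorems.PortZD

open Literature.MathematicalPhysics.QuantumFieldTheory.Balaban1983to89
open Literature.MathematicalPhysics.QuantumFieldTheory.Balaban1983to89.Node00
open Literature.MathematicalPhysics.QuantumFieldTheory.Balaban1983to89.Node00.ZeroInput
open Summit.QuantumFields.YangMills.BalabanUVNodes.N09FlatSectorUniqueness (uniqueUkOrbit_one mem_bgReg_of_flat_of_mem isBackground_of_flat flat_one)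
open Summit.QuantumFields.YangMills.Theorems.K0RecordFormatNames (thetaFill unitField recordΦfAx)
open Summit.QuantumFields.YangMills.Theorems.BalabanUVNodesPortS1 (recordΦfAx_eq_mergedTermT_unitField unitField_zero)
open B15Claim189UnitTestAtRecord (iter_avOfRecord_one)
open B12Eq019ActionBody (nextAction nextAction_one)
open T4FlagMemory (extd)
open T4Continuum (T4Family)

variable (F : T4Family) (N : ℕ) [NeZero N]

/-! ## §1  The one-step rows with the minimiser selector DISPLAYED (lit `action21`'s design); `sel := Uk` gives the lit rows by `rfl` -/

/-- **`R^{sel}_k(A)(W) := log[(T_k χ_k e^{−GF∕g_k² + A})(W)∕𝐍_k(A)] − A(Ū^k(sel_{k+1} W))`** — lit `ZeroInput.stepOutT` with the (0.21) minimiser selector as an argument.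
[cite: Balaban1987RG1, (0.19) p.255, (1.6) p.261, (0.21) p.256] -/
def stepOutWithT (sel : (K k : ℕ) → ℝ → GaugeField (F.P K) k (SU N) → GaugeField (F.P K) 0 (SU N)) (T : Transport F N)
    (χ : (K : ℕ) → (ℕ → ℝ) → (k : ℕ) → Density (F.P K) k (SU N)) (ε : ℝ) (K : ℕ) (g : ℕ → ℝ) (k : ℕ)
    (A : Density (F.P K) k (SU N)) (W : GaugeField (F.P K) (k + 1) (SU N)) : ℝ :=
  nextAction (T K k) (χ K g k) (gfOfRecord F N K k) (g k) A W - A (Averaging.iter (avOfRecord F N K) k (sel K (k + 1) ε W))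

/-- **`𝓝^{sel}_{k+1}(g; W) := A_{k+1}(g; W) − A_k(g; Ū^k(sel_{k+1}(W)))`** — lit `mergedTermT` ((1.6)) with the minimiser selector as an argument.
[cite: Balaban1987RG1, (1.6) p.261, (0.21) p.256] -/
def mergedTermWithT (sel : (K k : ℕ) → ℝ → GaugeField (F.P K) k (SU N) → GaugeField (F.P K) 0 (SU N)) (T : Transport F N)
    (χ : (K : ℕ) → (ℕ → ℝ) → (k : ℕ) → Density (F.P K) k (SU N)) (ε : ℝ) (K : ℕ) (g : ℕ → ℝ) (k : ℕ)
    (W : GaugeField (F.P K) (k + 1) (SU N)) : ℝ :=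
  effActionHT F N T χ K g (k + 1) W - effActionHT F N T χ K g k (Averaging.iter (avOfRecord F N K) k (sel K (k + 1) ε W))

/-- The β-layer family shape of `𝓝^{sel}` read through `r : 𝔄 → SU(N)` — lit `mergedTermFamilyT` with the selector as an argument. [cite: Balaban1987RG1, (1.20)–(1.22) p.264] -/
def mergedTermFamilyWithT (sel : (K k : ℕ) → ℝ → GaugeField (F.P K) k (SU N) → GaugeField (F.P K) 0 (SU N)) (T : Transport F N)
    (χ : (K : ℕ) → (ℕ → ℝ) → (k : ℕ) → Density (F.P K) k (SU N)) (ε : ℝ) {𝔄 : Type*} (r : 𝔄 → SU N) :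
    (k : ℕ) → (Fin (k + 1) → ℝ) → (K : ℕ) → ((Fin (F.P K).d → Site (F.P K) (k + 1) → 𝔄) → ℝ) :=
  fun k hist K W => mergedTermWithT F N sel T χ ε K (extd hist) k (readField F N r W)

/-- The matrix-carrier export of `𝓝^{sel}` — lit `mergedTermFamilyMatT` with the selector as an argument (the shape `ΦfOf`∕`recordTermsAx` read).
[cite: Balaban1987RG1, (1.20)–(1.22) p.264] -/
def mergedTermFamilyMatWithT (sel : (K k : ℕ) → ℝ → GaugeField (F.P K) k (SU N) → GaugeField (F.P K) 0 (SU N)) (T : Transport F N)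
    (χ : (K : ℕ) → (ℕ → ℝ) → (k : ℕ) → Density (F.P K) k (SU N)) (ε : ℝ) :
    (k : ℕ) → (Fin (k + 1) → ℝ) → (K : ℕ) → ((Fin (F.P K).d → Site (F.P K) (k + 1) → Matrix (Fin N) (Fin N) ℂ) → ℝ) :=
  mergedTermFamilyWithT F N sel T χ ε (suOfMat N)

/-- At the bare choice `sel := Uk` the displayed-selector step functional IS lit `stepOutT`. [cite: Balaban1987RG1, (1.6) p.261 (bookkeeping)] -/
theorem stepOutWithT_Uk : stepOutWithT F N (Uk F N) = stepOutT F N := rfl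

/-- At `sel := Uk` the displayed-selector merged term IS lit `mergedTermT`. [cite: Balaban1987RG1, (1.6) p.261 (bookkeeping)] -/
theorem mergedTermWithT_Uk : mergedTermWithT F N (Uk F N) = mergedTermT F N := rfl

/-- At `sel := Uk` the family IS lit `mergedTermFamilyT`. [cite: Balaban1987RG1, (1.20) p.264 (bookkeeping)] -/
theorem mergedTermFamilyWithT_Uk (T : Transport F N) (χ : (K : ℕ) → (ℕ → ℝ) → (k : ℕ) → Density (F.P K) k (SU N)) (ε : ℝ) {𝔄 : Type*} (r : 𝔄 → SU N) :
    mergedTermFamilyWithT F N (Uk F N) T χ ε r = mergedTermFamilyT F N T χ ε r := rfl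

/-- At `sel := Uk` the matrix export IS lit `mergedTermFamilyMatT` (the token `recordTermsAx` reads today). [cite: Balaban1987RG1, (1.20) p.264 (bookkeeping)] -/
theorem mergedTermFamilyMatWithT_Uk (T : Transport F N) (χ : (K : ℕ) → (ℕ → ℝ) → (k : ℕ) → Density (F.P K) k (SU N)) (ε : ℝ) :
    mergedTermFamilyMatWithT F N (Uk F N) T χ ε = mergedTermFamilyMatT F N T χ ε := rfl

/-- `𝓝^{sel}_{k+1} = R^{sel}_k(A_k)` (`rfl` with `effActionHT_succ`). [cite: Balaban1987RG1, (1.6) p.261 (bookkeeping)] -/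
theorem mergedTermWithT_eq_stepOutWith (sel : (K k : ℕ) → ℝ → GaugeField (F.P K) k (SU N) → GaugeField (F.P K) 0 (SU N)) (T : Transport F N)
    (χ : (K : ℕ) → (ℕ → ℝ) → (k : ℕ) → Density (F.P K) k (SU N)) (ε : ℝ) (K : ℕ) (g : ℕ → ℝ) (k : ℕ) (W : GaugeField (F.P K) (k + 1) (SU N)) :
    mergedTermWithT F N sel T χ ε K g k W = stepOutWithT F N sel T χ ε K g k (effActionHT F N T χ K g k) W := rfl

/-! ## §2  The unit rows: `R^{sel}_k(A)(1) = −A(Ū^k(sel_{k+1} 1))` for any selector; at the ROOTED selector `𝓝^{sel}_{k+1}(1) = 0` UNCONDITIONALLY -/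

/-- `R^{sel}_k(A)(1) = −A(Ū^k(sel_{k+1}(1)))` (`(T_k ρ)(1)∕𝐍_k = 1`, `nextAction_one`). [cite: Balaban1987RG1, (0.19) p.255, (2.12) p.268] -/
theorem stepOutWithT_one (sel : (K k : ℕ) → ℝ → GaugeField (F.P K) k (SU N) → GaugeField (F.P K) 0 (SU N)) (T : Transport F N)
    (χ : (K : ℕ) → (ℕ → ℝ) → (k : ℕ) → Density (F.P K) k (SU N)) (ε : ℝ) (K : ℕ) (g : ℕ → ℝ) (k : ℕ) (A : Density (F.P K) k (SU N)) :
    stepOutWithT F N sel T χ ε K g k A 1 = - A (Averaging.iter (avOfRecord F N K) k (sel K (k + 1) ε 1)) := by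
  rw [stepOutWithT, nextAction_one, zero_sub]

variable {F N} in
/-- **`UkSel … 1 = 1`, every `N`** (✓`…PortS1Selector.UkSel_one` is the `N = 2` instance; same proof): over the unit coarse field the unit fine field is a minimiser (flat sector) and the
minimal orbit is unique (✓`uniqueUkOrbit_one`), so the rooted selector returns `rootGauge k 1 = 1`; off the solvable set the documented default is `1`.
[cite: Balaban1985Variational, Thm 1 p.279; Balaban1987RG1, (0.21) p.256, (2.3) p.265] -/
theorem UkSel_one_of_le {K k : ℕ} (hk : k ≤ (F.P K).m + (F.P K).K) (ε : ℝ) : UkSel F N K k ε (1 : GaugeField (F.P K) k (SU N)) = 1 := by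
  by_cases h : UkExists F N K k ε (1 : GaugeField (F.P K) k (SU N))
  · obtain ⟨U₀, hU₀⟩ := h
    have hmem : (1 : GaugeField (F.P K) 0 (SU N)) ∈ bgReg F N K k ε := mem_bgReg_of_flat_of_mem (F := F) (N := N) (flat_one (P := F.P K) (j := 0)) hU₀.2.1
    have hbg : IsBackground (avOfRecord F N K) (bgReg F N K k ε) k (1 : GaugeField (F.P K) k (SU N)) 1 := by
      have h1 := isBackground_of_flat (F := F) (N := N) (k := k) (flat_one (P := F.P K) (j := 0)) hmem
      rwa [iter_avOfRecord_one F N K k] at h1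
    rw [← rootGauge_eq_UkSel_of_isBackground hk (uniqueUkOrbit_one (F := F) (N := N) hk ε) hbg, T4RootedResidualGauge.rootGauge_one]
  · exact UkSel_of_not h

variable {F N} in
/-- **`Ū^k(UkSel_{k+1}(1)) = 1`** (`k + 1 ≤ m + K`): the rooted minimiser over the unit is `1` and averages of `1` are `1` (◆ CRIT-1 g40's `iter_UkSel_succ_one`).
[cite: Balaban1987RG1, (2.3) p.265, (0.21) p.256] -/
theorem iter_UkSel_succ_one {K k : ℕ} (hk : k + 1 ≤ (F.P K).m + (F.P K).K) (ε : ℝ) :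
    Averaging.iter (avOfRecord F N K) k (UkSel F N K (k + 1) ε (1 : GaugeField (F.P K) (k + 1) (SU N))) = 1 := by
  rw [UkSel_one_of_le hk ε, iter_avOfRecord_one F N K k]

/-- ★ **`𝓝^{sel}_{k+1}(1) = 0` AT THE ROOTED SELECTOR, EVERY `k`, NO INVARIANCE HYPOTHESIS**: `A_{k+1}(1) − A_k(Ū^k(UkSel_{k+1}(1))) = 0 − A_k(1) = 0` for every transport, cut-off
family, radius and history (`k + 1 ≤ m + K`).  Compare ✓`mergedTermT_one_of_gaugeInvariant` (bare `Uk`: needs GLOBAL gauge invariance of `A_k`).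
[cite: Balaban1987RG1, (2.12) p.268 («the normalization constant … at U_{k+1} = 1»), (1.6) p.261, (2.3) p.265] -/
theorem mergedTermWithT_UkSel_one (T : Transport F N) (χ : (K : ℕ) → (ℕ → ℝ) → (k : ℕ) → Density (F.P K) k (SU N)) (ε : ℝ) {K : ℕ} (g : ℕ → ℝ) {k : ℕ}
    (hk : k + 1 ≤ (F.P K).m + (F.P K).K) :
    mergedTermWithT F N (UkSel F N) T χ ε K g k 1 = 0 := by
  rw [mergedTermWithT, iter_UkSel_succ_one hk, effActionHT_one, effActionHT_one, sub_zero]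

/-! ## §3  The located gap between the bare row and the rooted row at `W = 1` -/

/-- `𝓝_{k+1}(1) = −A_k(Ū^k(Uk_{k+1}(1)))` (bare choice). [cite: Balaban1987RG1, (1.6) p.261, (2.12) p.268] -/
theorem mergedTermT_one_eq_neg (T : Transport F N) (χ : (K : ℕ) → (ℕ → ℝ) → (k : ℕ) → Density (F.P K) k (SU N)) (ε : ℝ) (K : ℕ) (g : ℕ → ℝ) (k : ℕ) :
    mergedTermT F N T χ ε K g k 1 = - effActionHT F N T χ K g k (Averaging.iter (avOfRecord F N K) k (Uk F N K (k + 1) ε 1)) := by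
  rw [mergedTermT_eq_stepOut, stepOutT_one]

/-- **`𝓝_{k+1}(1) = 0 ↔ hinv`**: the bare row vanishes at the unit EXACTLY when `A_k(Ū^k(Uk_{k+1}(1))) = A_k(1)` (`A_k(1) = 0`). [cite: Balaban1987RG1, (2.12) p.268, (1.6) p.261] -/
theorem mergedTermT_one_eq_zero_iff (T : Transport F N) (χ : (K : ℕ) → (ℕ → ℝ) → (k : ℕ) → Density (F.P K) k (SU N)) (ε : ℝ) (K : ℕ) (g : ℕ → ℝ) (k : ℕ) :
    mergedTermT F N T χ ε K g k 1 = 0 ↔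
      effActionHT F N T χ K g k (Averaging.iter (avOfRecord F N K) k (Uk F N K (k + 1) ε 1)) = effActionHT F N T χ K g k 1 := by
  rw [mergedTermT_one_eq_neg, effActionHT_one, neg_eq_zero]

/-- **THE GAP, TO THE TOKEN**: `𝓝_{k+1}(1) − 𝓝^{sel}_{k+1}(1) = −A_k(Ū^k(Uk_{k+1}(1)))` at the rooted selector (`k + 1 ≤ m + K`) — the (N-0) door is the bare-vs-rooted selector
mismatch and nothing else. [cite: Balaban1987RG1, (2.12) p.268, (2.3) p.265] -/
theorem mergedTermT_one_sub_sel_one (T : Transport F N) (χ : (K : ℕ) → (ℕ → ℝ) → (k : ℕ) → Density (F.P K) k (SU N)) (ε : ℝ) {K : ℕ} (g : ℕ → ℝ) {k : ℕ}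
    (hk : k + 1 ≤ (F.P K).m + (F.P K).K) :
    mergedTermT F N T χ ε K g k 1 - mergedTermWithT F N (UkSel F N) T χ ε K g k 1 =
      - effActionHT F N T χ K g k (Averaging.iter (avOfRecord F N K) k (Uk F N K (k + 1) ε 1)) := by
  rw [mergedTermWithT_UkSel_one F N T χ ε g hk, sub_zero, mergedTermT_one_eq_neg]

/-! ## §4  At the record (`N = 2`, `θ = thetaFill F a₀ ε₂₉`, history `extd v`): the door in `recordΦfAx`, and the rooted family through the SAME chart -/

/-- **`recordΦfAx … 0 = −A_k(Ū^k(Uk_{k+1}(1)))`** (complexified): `W_0 = 1` (✓`unitField_zero`) and §3. [cite: Balaban1987RG1, (1.6) p.261, (2.12) p.268, (1.20) p.264] -/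
theorem recordΦfAx_apply_zero_eq_neg (a₀ ε₂₉ : ℝ) (k : ℕ) (v : Fin (k + 1) → ℝ) (K : ℕ) :
    letI θ := thetaFill F a₀ ε₂₉
    letI := θ.instVβ₁; letI := θ.instVβ₂
    recordΦfAx F a₀ ε₂₉ k v K 0 =
      ((- effActionHT F 2 (TβOfRecord₁₃ F 2) (chiβOfRecord₁₃Ax F 2 θ) K (extd v) k
          (Averaging.iter (avOfRecord F 2 K) k (Uk F 2 K (k + 1) θ.εbg 1)) : ℝ) : ℂ) := by
  rw [recordΦfAx_eq_mergedTermT_unitField, unitField_zero, mergedTermT_one_eq_neg]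

/-- ★ **THE (N-0) DOOR IS EXACTLY `hinv`**: `recordΦfAx … 0 = 0 ↔ A_k(Ū^k(Uk_{k+1}(1))) = A_k(1)` (✓`recordΦfAx_apply_zero_of_eq` is the `←` half). [cite: Balaban1987RG1, (2.12) p.268, (1.6) p.261] -/
theorem recordΦfAx_apply_zero_iff (a₀ ε₂₉ : ℝ) (k : ℕ) (v : Fin (k + 1) → ℝ) (K : ℕ) :
    letI θ := thetaFill F a₀ ε₂₉
    letI := θ.instVβ₁; letI := θ.instVβ₂
    recordΦfAx F a₀ ε₂₉ k v K 0 = 0 ↔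
      effActionHT F 2 (TβOfRecord₁₃ F 2) (chiβOfRecord₁₃Ax F 2 θ) K (extd v) k (Averaging.iter (avOfRecord F 2 K) k (Uk F 2 K (k + 1) θ.εbg 1)) =
        effActionHT F 2 (TβOfRecord₁₃ F 2) (chiβOfRecord₁₃Ax F 2 θ) K (extd v) k 1 := by
  rw [recordΦfAx_apply_zero_eq_neg, Complex.ofReal_eq_zero, effActionHT_one, neg_eq_zero]

/-- **The rooted family through the record's chart IS `𝓝^{sel}_{k+1}(extd v; W_B)`** (`rfl`, the twin of ✓`recordΦfAx_eq_mergedTermT_unitField`): what `recordΦfAx` would read after the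
one-token names edition `recordTermsAx := mergedTermFamilyMatWithT F 2 (UkSel F 2) …` (DEF-1's pen, NOT done here). [cite: Balaban1987RG1, (1.6) p.261, (1.20) p.264, (2.3) p.265] -/
theorem ΦfOf_mergedTermFamilyMatWithT_eq (sel : (K k : ℕ) → ℝ → GaugeField (F.P K) k (SU 2) → GaugeField (F.P K) 0 (SU 2)) (a₀ ε₂₉ : ℝ) (k : ℕ)
    (v : Fin (k + 1) → ℝ) (K : ℕ) (B : K0RecordFormatNames.recordW F a₀ ε₂₉ k K) :
    letI θ := thetaFill F a₀ ε₂₉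
    letI := θ.instVβ₁; letI := θ.instVβ₂
    K0RecordFormatNames.ΦfOf F (mergedTermFamilyMatWithT F 2 sel (TβOfRecord₁₃ F 2) (chiβOfRecord₁₃Ax F 2 θ) θ.εbg) θ.ρ8 k v K B =
      ((mergedTermWithT F 2 sel (TβOfRecord₁₃ F 2) (chiβOfRecord₁₃Ax F 2 θ) θ.εbg K (extd v) k (unitField F θ k K B) : ℝ) : ℂ) := rfl

/-- ★★ **AT THE ROOTED SELECTOR THE CHARTED FAMILY VANISHES AT `B = 0`, EVERY `k`, UNCONDITIONALLY** (`k + 1 ≤ m + K`): the statement `recordΦfAx … 0 = 0` would have after the edition.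
[cite: Balaban1987RG1, (2.12) p.268 («the normalization constant … at U_{k+1} = 1»), (1.6) p.261, (2.3) p.265] -/
theorem ΦfOf_mergedTermFamilyMatWithT_UkSel_apply_zero (a₀ ε₂₉ : ℝ) (k : ℕ) (v : Fin (k + 1) → ℝ) (K : ℕ) (hk : k + 1 ≤ (F.P K).m + (F.P K).K) :
    letI θ := thetaFill F a₀ ε₂₉
    letI := θ.instVβ₁; letI := θ.instVβ₂
    K0RecordFormatNames.ΦfOf F (mergedTermFamilyMatWithT F 2 (UkSel F 2) (TβOfRecord₁₃ F 2) (chiβOfRecord₁₃Ax F 2 θ) θ.εbg) θ.ρ8 k v K 0 = 0 := by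
  rw [ΦfOf_mergedTermFamilyMatWithT_eq, unitField_zero, mergedTermWithT_UkSel_one F 2 _ _ _ _ hk, Complex.ofReal_zero]

end Summit.QuantumFields.YangMills.Theorems.PortZD

end
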